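import Literature.MathematicalPhysics.QuantumFieldTheory.Balaban1983to89.B15Claim189PrintedConditions

/-!
# `Balaban1983to89.B15Claim189N0OfRecord` — YM-DAG node N12 · [Balaban1989LargeFieldI] CMP **122** (1989) 175–202, p. 200: THE NUMBER `N₀` OF RECORD (*"recall that
# it is defined by the equation L^{−N₀+1}R_{k−N₀+1} = 1"*) and PRINT'S FIRST p. 200 CONDITION *"O(1)B₃B₅M⁵L₀^{−2(N₀−1)} ≦ 1/4 … The number on the right-hand side is
# ≦ 1/4 for R_k^{−α₀}, or γ sufficiently small"* DISCHARGED from the definition of `N₀`, the monotone coupling history and ONE threshold on the top coupling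

statement-level bookkeeping over published theorems with citation tags; kernel-checked compositions of tree theorems and elementary real analysis; nothing here is a
claim about the Yang–Mills mass gap.

CITATION HEADER (lean-in-tree rule).  Source: [Balaban1989LargeFieldI] («[IV]») p. 200, verbatim (page image re-read by this seat, `…/1989-cmp122-large-field-I-p026-x2.png`):
*"(4α + O(1)B₃B₅M⁵L₀^{−2(k−j)})ε_j(L^{k−j}η)² ≦ (1 − β)L₀^{2(j−k₀−1)}ε_j(L^{k−j}η)² if O(1)B₃B₅M⁵L₀^{−2(N₀−1)} ≦ 1/4. From the definition of the number N₀ (recall that it is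
defined by the equation L^{−N₀+1}R_{k−N₀+1} = 1) we get O(1)B₃B₅M⁵L₀^{−2(N₀−1)} ≦ O(1)B₃B₅M⁵L₀²R_k^{−α₀}, where α₀ = (log L₀²)/(log L). The number on the right-hand side is
≦ 1/4 for R_k^{−α₀}, or γ sufficiently small."*; p. 181 (*"k₀ = k − N₀"*); [Balaban1988Convergent] («[III]») (2.5) p. 255 (*"R_j is the smallest number of the form L^r such,
that R_j ≧ (log g_j⁻²)^r"*), (2.6) p. 255 (monotone couplings); [Balaban1987RG1] (0.20) p. 256 (the recursion `g_{k+1}⁻² = g_k⁻² − β_{k+1}`).  Seat `pub-ymgap-dag-n12-e` (YM-PLAN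
Track A, HUMAN RULING D-0062; director-ym R134 row N12 s3), module 12 (generation 4).  BY NAME and UNCHANGED: def-R's `Node00.RkOfRecord` ∕ `isRj_RkOfRecord` ∕ `exists_pow_ge_of_two_le`
((2.5) of record), `FlowStepRuns.genSeq` ∕ `genSeq_succ` ∕ `solveCoupling` ((0.20)), `Node00.gOfRecord₁₀ ∕ betaOfRecord₁₀`, module 11 (`sitOfTerm`, `claim189_sitOfTerm_of_inInterval ∕ _of_flow`,
`h189_pinD189T_of_h180 ∕ _of_flow`, `ResidW.pinD189T`), module 10 (`Sit189.pinNumerics`).  The antitonicity of `R` in the coupling is dag-n21's `RkOfRecord_antitone`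
(`Thm/BalabanUVNodesN21CubeSyncAtRecord`, a Summits file not importable here) re-derived in three lines (`RkOfRecord_anti`).

PRIMARY LOCATOR (v1.1; page image `…-p005-x2.png` re-read): p. 179, verbatim: *"Take the smallest positive integer N₀ such, that L^{−N₀+1}MR_{k−N₀+1} = M. It is easy to see that
either there is exactly one such integer, or there are two. We assume that N > N₀, in fact it will become clear later that N is much greater than N₀."*  So print's `N₀` is the LEAST
positive solution of `R_{k−N₀+1} = L^{N₀−1}`, and `N > N₀` is print's STANDING ASSUMPTION (the displayed `N₀ ≤ Nmem` below).  `N0OfSeq` takes the least positive solution of the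
INEQUALITY `R_{k+1−n} ≤ L^{n−1}` (always solvable); it coincides with print's number whenever `R_j` drops by at most one factor `L` per step (p. 177 *"in some steps the number R_k
decreases by the factor L⁻¹"*) — then `n ↦ log_L R_{k+1−n} − (n − 1)` decreases by `0` or `1` per step and first vanishes exactly where the inequality first holds (LOCATED, not
proved here; on a stationary history the two agree on the nose, `N0OfSeq_const`).

WHY THIS FILE.  Module 10 pinned `k₀ := k − N₀` with print's second memory `N₀` a PARAMETER, and module 11 left print's first p. 200 condition displayed as a numeric side
condition `hN₀ : (2 + (121/120)²O(1)B₃B₅M⁵)·(L₀²)^{−(N₀−1)} ≤ 1/4`.  But print DEFINES `N₀` from the record — the cube numbers `R_j = L^{s_j}` of (2.5) along the run — by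
`R_{k−N₀+1} = L^{N₀−1}`, and DISCHARGES the condition from that definition: `L₀^{2(N₀−1)} = (L^{N₀−1})^{α₀} ≥ R_k^{α₀} ≥ (log g_k⁻²)^{rα₀}`, which beats any constant once `g_k`
is small (*"or γ sufficiently small"*).  Here `N₀` becomes an OBJECT OF RECORD (per run and level: the least `n ≥ 1` with `R_{k+1−n} ≤ L^{n−1}` — print's equation at its
first solution; always solvable) and the condition becomes a THEOREM of one threshold on the top coupling, `4(2 + (121/120)²O(1)B₃B₅M⁵) ≤ ((log g_k⁻²)^r)^{α₀}`, given that
the couplings do not decrease along the run (⇐ `β ≥ 0` along the history, the sign behind (2.6); displayed — the tree notes it is not printed in [I]).  `2 ≤ N₀` becomes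
`1 < (log g_k⁻²)^r`; `N₀ ≤ N` and `N₀ ≤ k` stay displayed (print: *"N … sufficiently large"*, and the first steps carry no large fields).

WHAT THIS FILE PROVES (0 `sorry`; defs `N0OfSeq`, `N0OfRecord`, `Node00.ResidW.pinD189N`).
§1 (generic) `RkOfRecord_anti`, `log_pow_le_RkOfRecord`, `one_lt_RkOfRecord_of`; `N0OfSeq L r g k` + `exists_N0`, `N0OfSeq_spec`, `N0OfSeq_le_of`, `lt_RkOfRecord_of_lt_N0OfSeq`
   (minimality), `two_le_N0OfSeq`, `RkOfRecord_le_pow_N0OfSeq` (`R_k ≤ L^{N₀−1}` for non-decreasing couplings).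
§2 (generic real analysis) `pow_rpow_alpha0` (`(L^{n})^{α₀} = (L₀²)^n`), **`printCond1_of_threshold`** (`(2 + C)·(L₀²)^{−(N₀−1)} ≤ 1/4` ⇐ `R_k ≤ L^{N₀−1}`, `(log g_k⁻²)^r ≤ R_k`,
   `4(2 + C) ≤ ((log g_k⁻²)^r)^{α₀}`), **`threshold_of_le_gamma0`** (the threshold from `g ≤ γ₀`, EXPLICIT `γ₀ = exp(−((max(4(2+C),1))^{1/α₀})^{1/r}/2)`).
§3 (generic, (0.20)) `genSeq_le_succ_of_beta_nonneg`, `genSeq_mono_of_beta_nonneg` (non-decreasing couplings from `β ≥ 0` along the history, in the window),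
   `betaAlongHistory_nonneg_of_betaLowerH` (`β ≥ 0` along the history from the BOX bound `BetaLowerH b γ β`, `b ≥ 0`).
§4 (at the record) `N0OfRecord θ P k`, `two_le_N0OfRecord`, `one_lt_log_pow_of_inInterval` (`2 ≤ N₀` in a (2.7)-small window, `r ≥ 1`), `RkOfRecord_le_pow_N0OfRecord`, **`printCond1_N0OfRecord_of_threshold`**; **`claim189_sitOfTerm_N0_of_inInterval`** (module 11's display theorem
   with `N₀ := N0OfRecord θ P k′`, `hN2` and `hN₀` REPLACED by `r ≥ 1` (window form) ∕ `1 < (log g_{k′}⁻²)^r` (flow form), `β ≥ 0` along the history and the threshold);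
   `ResidW.pinD189N` (+ faces),
   **`h189_pinD189N_of_h180`** ∕ **`h189_pinD189N_of_h180_of_flow`**.
§6 (v1.2) `betaAlongHistory_nonneg_of_betaPositive` (the displayed `β ≥ 0` along the history IS the DAG's `betaPositive` leaf of the run), `gOfRecord₁₀_mono_of_leaves`;
§7 (v1.2) `N0OfSeq_le_succ_log` ∕ `N0OfRecord_le_succ_log` (per run `N₀ ≤ 1 + log_L R(g₀)`: the memory ONE run needs), `N0OfSeq_le_of_log_pow_le` ∕
   **`N0OfRecord_le_Nmem_of_log_pow_le`** (the displayed `N₀(P) ≤ Nmem` DISCHARGED from `(log g₀⁻²)^r ≤ L^{Nmem−1}` — a lower edge on the run's INITIAL coupling).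
§5 (v1.1, census) `log_pow_le_pow_of_N0OfSeq_le` ∕ `log_pow_le_pow_of_N0OfRecord_le` (`N₀ ≤ N` at CONSTANT `N` forces `(log g_k⁻²)^r ≤ L^{N−1}`: a lower edge on the window;
   print's `N` grows with `k`, p. 198), `N0OfSeq_const` (`N₀ = 1 + log_L R` on a stationary history).

HONEST FRAMING.  Count-neutral: a definition of record + kernel bookkeeping + elementary real analysis; nothing of Bałaban's asserted (the ℍ-leaves, (1.80), Proposition 1,
positive mass, the located geometry, print's SECOND condition (on `M`), `β, L₀`, signs, `N₀ ≤ N`, `N₀ ≤ k`, the window ∕ flow inputs and `β ≥ 0` stay displayed); N12 NOT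
discharged; one finite four-torus programme at fixed `ε`, Bałaban AS PRINTED with locators; nothing continuum ∕ ℝ⁴ ∕ OS ∕ mass gap ∕ Clay.  No `sorry`, no `axiom`, no `instance`,
no `notation`.  LOCATED (dag-n12-d g5 LOCATED-1, 2026-08-27; not a gap): at the witness tower numerics of record `towerNumericsOfRecord₁₂` (`Nmem = 0`, node00-def-K0a) the displayed
`N₀(P) ≤ Nmem` is unsatisfiable (`1 ≤ N₀(P)` always, `N0OfSeq_spec`), so the record-level theorems below — like every (1.89) route through `h = k − N` — instantiate only at tower
numerics with `Nmem ≥ N₀(P) ≥ 2` (print's standing `N`, p. 198 *"N has to be sufficiently large"*); a design input for the numerics-of-the-family successor record.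
-/

noncomputable section

open scoped BigOperators
open MeasureTheory

namespace Literature.MathematicalPhysics.QuantumFieldTheory.Balaban1983to89

namespace B15Claim189N0OfRecord

open Node00 (RkOfRecord isRj_RkOfRecord exists_pow_ge_of_two_le)

/-! ## §1. Generic: `R` of (2.5) bookkeeping and the number `N₀` of a coupling sequence -/

section Generic

variable {L : ℕ}

/-- `(log g⁻²)^r ≤ R(g)` — the defining inequality of (2.5) for `R` of record (`L ≥ 2`). [cite: Balaban1988Convergent, (2.5) p.255] -/
theorem log_pow_le_RkOfRecord (hL : 2 ≤ L) (r : ℕ) (g : ℝ) : (Real.log (g ^ 2)⁻¹) ^ r ≤ (RkOfRecord L r g : ℝ) := by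
  obtain ⟨s, _, h, _⟩ := isRj_RkOfRecord hL r g
  exact h

/-- `R(g) = L^s` with `s` minimal: any power of `L` above `(log g⁻²)^r` is above `R(g)` (`L ≥ 2`). [cite: Balaban1988Convergent, (2.5) p.255] -/
theorem RkOfRecord_le_pow_of_le (hL : 2 ≤ L) (r : ℕ) (g : ℝ) {t : ℕ} (ht : (Real.log (g ^ 2)⁻¹) ^ r ≤ ((L ^ t : ℕ) : ℝ)) : RkOfRecord L r g ≤ L ^ t := by
  obtain ⟨s, hs, _, hmin⟩ := isRj_RkOfRecord hL r g
  rw [hs]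
  exact Nat.pow_le_pow_right (by omega) (hmin t ht)

/-- **`R` IS ANTITONE IN THE COUPLING** on `]0, 1]`: `0 < g ≤ g′ ≤ 1 ⇒ R(g′) ≤ R(g)` (the larger coupling has the smaller `log g⁻²`; dag-n21's `RkOfRecord_antitone`, re-derived).
[cite: Balaban1988Convergent, (2.5) p.255; Balaban1989LargeFieldI, p.177 («in some steps the number R_k decreases by the factor L⁻¹»)] -/
theorem RkOfRecord_anti (hL : 2 ≤ L) (r : ℕ) {g g' : ℝ} (hg : 0 < g) (hgg' : g ≤ g') (hg'1 : g' ≤ 1) : RkOfRecord L r g' ≤ RkOfRecord L r g := by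
  have hg' : 0 < g' := lt_of_lt_of_le hg hgg'
  have hone : 1 ≤ (g' ^ 2)⁻¹ := one_le_inv_iff₀.mpr ⟨by positivity, by nlinarith⟩
  have hlog0 : 0 ≤ Real.log (g' ^ 2)⁻¹ := Real.log_nonneg hone
  have hlog : Real.log (g' ^ 2)⁻¹ ≤ Real.log (g ^ 2)⁻¹ := Real.log_le_log (by positivity) (inv_anti₀ (by positivity) (by nlinarith))
  have hpow : (Real.log (g' ^ 2)⁻¹) ^ r ≤ (Real.log (g ^ 2)⁻¹) ^ r := pow_le_pow_left₀ hlog0 hlog r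
  obtain ⟨s, hs, h, _⟩ := isRj_RkOfRecord hL r g
  have ht : (Real.log (g' ^ 2)⁻¹) ^ r ≤ ((L ^ s : ℕ) : ℝ) := by
    rw [← hs]; exact hpow.trans h
  rw [hs]
  exact RkOfRecord_le_pow_of_le hL r g' ht

/-- `1 < R(g)` as soon as `1 < (log g⁻²)^r` (then the least exponent is positive). [cite: Balaban1988Convergent, (2.5) p.255] -/
theorem one_lt_RkOfRecord_of (hL : 2 ≤ L) (r : ℕ) {g : ℝ} (h : 1 < (Real.log (g ^ 2)⁻¹) ^ r) : 1 < RkOfRecord L r g := by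
  have h' : (1 : ℝ) < (RkOfRecord L r g : ℝ) := lt_of_lt_of_le h (log_pow_le_RkOfRecord hL r g)
  exact_mod_cast h'

open Classical in
/-- **THE NUMBER `N₀` OF A COUPLING SEQUENCE AT LEVEL `k`** — print p. 200 *"defined by the equation L^{−N₀+1}R_{k−N₀+1} = 1"*, read at its first solution: the least `n ≥ 1` with
`R(g_{k+1−n}) ≤ L^{n−1}` (`R` of (2.5); the index `k + 1 − n` is the natural-number difference; `0` in the never-occurring insoluble case). [cite: Balaban1989LargeFieldI, p.200, p.181 («k₀ = k − N₀»)] -/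
def N0OfSeq (L r : ℕ) (g : ℕ → ℝ) (k : ℕ) : ℕ :=
  if h : ∃ n : ℕ, 1 ≤ n ∧ RkOfRecord L r (g (k + 1 - n)) ≤ L ^ (n - 1) then Nat.find h else 0

variable (r : ℕ) (g : ℕ → ℝ) (k : ℕ)

/-- Print's equation for `N₀` is solvable (as an inequality): `n := k + 1 + s₀` with `R(g₀) = L^{s₀}` works (`L ≥ 2`). [cite: Balaban1989LargeFieldI, p.200 (bookkeeping)] -/
theorem exists_N0 (hL : 2 ≤ L) : ∃ n : ℕ, 1 ≤ n ∧ RkOfRecord L r (g (k + 1 - n)) ≤ L ^ (n - 1) := by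
  obtain ⟨s, hs, _, _⟩ := isRj_RkOfRecord hL r (g 0)
  refine ⟨k + 1 + s, by omega, ?_⟩
  rw [show k + 1 - (k + 1 + s) = 0 by omega, hs, show k + 1 + s - 1 = k + s by omega]
  exact Nat.pow_le_pow_right (by omega) (by omega)

/-- **THE DEFINING PROPERTY**: `1 ≤ N₀` and `R(g_{k+1−N₀}) ≤ L^{N₀−1}` (`L ≥ 2`). [cite: Balaban1989LargeFieldI, p.200] -/
theorem N0OfSeq_spec (hL : 2 ≤ L) : 1 ≤ N0OfSeq L r g k ∧ RkOfRecord L r (g (k + 1 - N0OfSeq L r g k)) ≤ L ^ (N0OfSeq L r g k - 1) := by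
  have h := exists_N0 r g k hL
  have hdef : N0OfSeq L r g k = Nat.find h := by
    unfold N0OfSeq; rw [dif_pos h]
  rw [hdef]
  exact Nat.find_spec h

/-- **MINIMALITY**: any `n ≥ 1` with `R(g_{k+1−n}) ≤ L^{n−1}` is at least `N₀`. [cite: Balaban1989LargeFieldI, p.200 (bookkeeping)] -/
theorem N0OfSeq_le_of (hL : 2 ≤ L) {n : ℕ} (h1 : 1 ≤ n) (h : RkOfRecord L r (g (k + 1 - n)) ≤ L ^ (n - 1)) : N0OfSeq L r g k ≤ n := by
  have hex := exists_N0 r g k hL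
  have hdef : N0OfSeq L r g k = Nat.find hex := by
    unfold N0OfSeq; rw [dif_pos hex]
  rw [hdef]
  exact Nat.find_min' hex ⟨h1, h⟩

/-- **MINIMALITY, CONTRAPOSED**: below `N₀` print's inequality fails — `L^{n−1} < R(g_{k+1−n})` for `1 ≤ n < N₀`. [cite: Balaban1989LargeFieldI, p.200 (bookkeeping)] -/
theorem lt_RkOfRecord_of_lt_N0OfSeq (hL : 2 ≤ L) {n : ℕ} (h1 : 1 ≤ n) (hn : n < N0OfSeq L r g k) : L ^ (n - 1) < RkOfRecord L r (g (k + 1 - n)) := by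
  by_contra h
  exact absurd (N0OfSeq_le_of r g k hL h1 (not_lt.mp h)) (by omega)

/-- **`2 ≤ N₀` FROM THE TOP COUPLING**: if `1 < (log g_k⁻²)^r` then `R(g_k) > 1 = L⁰`, so `n = 1` does not solve print's equation. [cite: Balaban1989LargeFieldI, p.200, p.181 (bookkeeping)] -/
theorem two_le_N0OfSeq (hL : 2 ≤ L) (hg : 1 < (Real.log (g k ^ 2)⁻¹) ^ r) : 2 ≤ N0OfSeq L r g k := by
  obtain ⟨h1, hspec⟩ := N0OfSeq_spec r g k hL
  by_contra hlt
  have hN : N0OfSeq L r g k = 1 := by omega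
  rw [hN, show k + 1 - 1 = k by omega, show (1 : ℕ) - 1 = 0 by rfl, pow_zero] at hspec
  have := one_lt_RkOfRecord_of hL r hg
  omega

/-- **`R_k ≤ L^{N₀−1}`** — the inequality print extracts from the definition of `N₀` (with `R_{k−N₀+1} ≥ R_k`: the couplings do not decrease along the run, so `R` does not
increase; `0 < g_{k+1−N₀} ≤ g_k ≤ 1`). [cite: Balaban1989LargeFieldI, p.200; Balaban1988Convergent, (2.5)–(2.6) p.255] -/
theorem RkOfRecord_le_pow_N0OfSeq (hL : 2 ≤ L) (hpos : 0 < g (k + 1 - N0OfSeq L r g k)) (hmono : g (k + 1 - N0OfSeq L r g k) ≤ g k) (hle : g k ≤ 1) :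
    RkOfRecord L r (g k) ≤ L ^ (N0OfSeq L r g k - 1) :=
  (RkOfRecord_anti hL r hpos hmono hle).trans (N0OfSeq_spec r g k hL).2

end Generic

/-! ## §2. Generic real analysis: print's first p. 200 condition from `R_k ≤ L^{N₀−1}` and one threshold on the top coupling -/

section Threshold

/-- `(L^n)^{α₀} = (L₀²)^n` for `α₀ = (log L₀²)/(log L)` (`L > 1`, `L₀ > 0`) — print's exponent `α₀`. [cite: Balaban1989LargeFieldI, p.200 («where α₀ = (log L₀²)/(log L)»)] -/
theorem pow_rpow_alpha0 {L L₀ : ℝ} (hL : 1 < L) (hL₀ : 0 < L₀) (n : ℕ) : (L ^ n) ^ (Real.log (L₀ ^ 2) / Real.log L) = (L₀ ^ 2) ^ n := by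
  have hLpos : 0 < L := by linarith
  have hlogL : Real.log L ≠ 0 := (Real.log_pos hL).ne'
  rw [Real.rpow_def_of_pos (pow_pos hLpos n), Real.log_pow]
  have h : (n : ℝ) * Real.log L * (Real.log (L₀ ^ 2) / Real.log L) = (n : ℝ) * Real.log (L₀ ^ 2) := by
    field_simp
  rw [h, Real.exp_nat_mul, Real.exp_log (pow_pos hL₀ 2)]

/-- **PRINT'S FIRST p. 200 CONDITION FROM THE DEFINITION OF `N₀` AND ONE THRESHOLD** (*"The number on the right-hand side is ≦ 1/4 for R_k^{−α₀}, or γ sufficiently small"*):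
with `C` the coefficient (at the record `C = (121/120)²O(1)B₃B₅M⁵`), `1 < L₀`, `2 ≤ L`, if `R_k ≤ L^{N₀−1}` (§1), `X ≤ R_k` with `X = (log g_k⁻²)^r ≥ 0` ((2.5)) and the threshold
`4(2 + C) ≤ X^{α₀}`, then `(2 + C)·((L₀²)^{N₀−1})⁻¹ ≤ 1/4` — because `X^{α₀} ≤ R_k^{α₀} ≤ (L^{N₀−1})^{α₀} = (L₀²)^{N₀−1}`. [cite: Balaban1989LargeFieldI, p.200] -/
theorem printCond1_of_threshold {L : ℕ} (hL : 2 ≤ L) {L₀ C X : ℝ} (hL₀ : 1 < L₀) {N₀ Rk : ℕ}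
    (hRk : Rk ≤ L ^ (N₀ - 1)) (hX0 : 0 ≤ X) (hX : X ≤ (Rk : ℝ)) (hwin : 4 * (2 + C) ≤ X ^ (Real.log (L₀ ^ 2) / Real.log L)) :
    (2 + C) * ((L₀ ^ 2) ^ (N₀ - 1))⁻¹ ≤ 1 / 4 := by
  have hLr : (1 : ℝ) < (L : ℝ) := by exact_mod_cast (lt_of_lt_of_le one_lt_two hL)
  have hL₀0 : 0 < L₀ := by linarith
  have hα0 : 0 ≤ Real.log (L₀ ^ 2) / Real.log L :=
    div_nonneg (Real.log_nonneg (by nlinarith)) (Real.log_nonneg hLr.le)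
  have hXR : X ≤ ((L : ℝ) ^ (N₀ - 1)) := by
    refine hX.trans ?_
    exact_mod_cast hRk
  have hD : 4 * (2 + C) ≤ (L₀ ^ 2) ^ (N₀ - 1) := by
    calc 4 * (2 + C) ≤ X ^ (Real.log (L₀ ^ 2) / Real.log L) := hwin
      _ ≤ ((L : ℝ) ^ (N₀ - 1)) ^ (Real.log (L₀ ^ 2) / Real.log L) := Real.rpow_le_rpow hX0 hXR hα0
      _ = (L₀ ^ 2) ^ (N₀ - 1) := pow_rpow_alpha0 hLr hL₀0 (N₀ - 1)
  have hDpos : 0 < (L₀ ^ 2) ^ (N₀ - 1) := pow_pos (pow_pos hL₀0 2) _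
  rw [← div_eq_mul_inv, div_le_iff₀ hDpos]
  linarith

/-- **«OR γ SUFFICIENTLY SMALL» WITH AN EXPLICIT `γ₀`**: for `α₀ > 0`, `r ≥ 1` and any `C`, every coupling `0 < g ≤ γ₀ := exp(−X/2)`, `X := ((max(4(2+C), 1))^{1/α₀})^{1/r}`,
passes the threshold `4(2 + C) ≤ ((log g⁻²)^r)^{α₀}` (since `log g⁻² ≥ log γ₀⁻² = X`). [cite: Balaban1989LargeFieldI, p.200 («or γ sufficiently small»)] -/
theorem threshold_of_le_gamma0 {C α₀ : ℝ} (hα : 0 < α₀) {r : ℕ} (hr : 1 ≤ r) {g : ℝ} (hg : 0 < g)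
    (hgγ : g ≤ Real.exp (-(((max (4 * (2 + C)) 1) ^ (1 / α₀)) ^ (1 / (r : ℝ)) / 2))) :
    4 * (2 + C) ≤ ((Real.log (g ^ 2)⁻¹) ^ r) ^ α₀ := by
  set T := max (4 * (2 + C)) 1 with hT
  have hT1 : 1 ≤ T := le_max_right _ _
  have hT0 : 0 ≤ T := by linarith
  set Y := T ^ (1 / α₀) with hY
  have hY0 : 0 ≤ Y := Real.rpow_nonneg hT0 _
  set X := Y ^ (1 / (r : ℝ)) with hX
  have hX0 : 0 ≤ X := Real.rpow_nonneg hY0 _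
  have hlog : X ≤ Real.log (g ^ 2)⁻¹ := by
    have h1 : (Real.exp (-(X / 2)) ^ 2)⁻¹ ≤ (g ^ 2)⁻¹ :=
      inv_anti₀ (by positivity) (pow_le_pow_left₀ hg.le hgγ 2)
    have h2 : Real.log ((Real.exp (-(X / 2)) ^ 2)⁻¹) = X := by
      rw [← Real.exp_nat_mul, Real.log_inv, Real.log_exp]; push_cast; ring
    calc X = Real.log ((Real.exp (-(X / 2)) ^ 2)⁻¹) := h2.symm
      _ ≤ Real.log (g ^ 2)⁻¹ := Real.log_le_log (by positivity) h1
  have hr0 : (r : ℝ) ≠ 0 := by exact_mod_cast (show r ≠ 0 by omega)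
  have hpow : Y ≤ (Real.log (g ^ 2)⁻¹) ^ r := by
    have hXr : X ^ r = Y := by
      rw [hX, ← Real.rpow_natCast, ← Real.rpow_mul hY0, one_div_mul_cancel hr0, Real.rpow_one]
    rw [← hXr]
    exact pow_le_pow_left₀ hX0 hlog r
  have hfin : T ≤ ((Real.log (g ^ 2)⁻¹) ^ r) ^ α₀ := by
    have hYα : Y ^ α₀ = T := by
      rw [hY, ← Real.rpow_mul hT0, one_div_mul_cancel hα.ne', Real.rpow_one]
    rw [← hYα]
    exact Real.rpow_le_rpow hY0 hpow hα.le
  exact (le_max_left _ _).trans hfin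

end Threshold

/-! ## §3. Generic (0.20): non-decreasing couplings from `β ≥ 0` along the history -/

section Monotone

open FlowStep (HBeta prefixOf Box mem_box BetaLowerH)
open FlowStepRuns (genSeq genSeq_succ solveCoupling solveCoupling_nonpos inv_sq_solveCoupling)

/-- **ONE STEP OF (0.20) WITH `β ≥ 0` DOES NOT DECREASE THE COUPLING**: `g_{j+1}⁻² = g_j⁻² − β_j(g_0,…,g_j) ≤ g_j⁻²`, so `g_j ≤ g_{j+1}` (both positive). [cite: Balaban1987RG1, (0.20) p.256; Balaban1988Convergent, (2.6) p.255] -/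
theorem genSeq_le_succ_of_beta_nonneg (β : HBeta) (g0 : ℝ) {j : ℕ} (hgj : 0 < genSeq β g0 j) (hpos : 0 < genSeq β g0 (j + 1))
    (hβ : 0 ≤ β j (prefixOf (genSeq β g0) j)) : genSeq β g0 j ≤ genSeq β g0 (j + 1) := by
  rw [genSeq_succ] at hpos ⊢
  set y := 1 / (genSeq β g0 j) ^ 2 - β j (prefixOf (genSeq β g0) j) with hy
  have hy0 : 0 < y := by
    by_contra h
    exact absurd (solveCoupling_nonpos (not_lt.mp h)) (not_le.mpr hpos)
  have hsq : 1 / (solveCoupling y) ^ 2 = y := inv_sq_solveCoupling hy0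
  have hyle : y ≤ 1 / (genSeq β g0 j) ^ 2 := by rw [hy]; linarith
  -- 1/(g')² ≤ 1/g² with g, g' > 0 gives g ≤ g'
  have h1 : 1 / (solveCoupling y) ^ 2 ≤ 1 / (genSeq β g0 j) ^ 2 := by rw [hsq]; exact hyle
  have hg2 : 0 < (genSeq β g0 j) ^ 2 := pow_pos hgj 2
  have hs2 : 0 < (solveCoupling y) ^ 2 := pow_pos hpos 2
  have h2 : (genSeq β g0 j) ^ 2 ≤ (solveCoupling y) ^ 2 := (one_div_le_one_div hs2 hg2).mp h1
  nlinarith [h2, add_pos hgj hpos]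

/-- **NON-DECREASING COUPLINGS IN THE WINDOW FROM `β ≥ 0` ALONG THE HISTORY**: if `0 < g_i` for `i ≤ n` and `β_j(g_0,…,g_j) ≥ 0` for `j < n`, then `g_i ≤ g_{i′}` for `i ≤ i′ ≤ n`.
[cite: Balaban1987RG1, (0.20) p.256; Balaban1988Convergent, (2.6) p.255] -/
theorem genSeq_mono_of_beta_nonneg (β : HBeta) (g0 : ℝ) {n : ℕ} (hpos : ∀ i, i ≤ n → 0 < genSeq β g0 i)
    (hβ : ∀ j, j < n → 0 ≤ β j (prefixOf (genSeq β g0) j)) {i i' : ℕ} (hii' : i ≤ i') (hi' : i' ≤ n) :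
    genSeq β g0 i ≤ genSeq β g0 i' := by
  induction i' with
  | zero =>
    have : i = 0 := by omega
    subst this; exact le_rfl
  | succ m ih =>
    rcases Nat.lt_or_ge i (m + 1) with hlt | hge
    · exact (ih (by omega) (by omega)).trans
        (genSeq_le_succ_of_beta_nonneg β g0 (hpos m (by omega)) (hpos (m + 1) hi') (hβ m (by omega)))
    · have : i = m + 1 := by omega
      subst this; exact le_rfl

/-- **`β ≥ 0` ALONG THE HISTORY FROM A BOX LOWER BOUND** (`FlowStep.BetaLowerH b γ β` with `0 ≤ b` — the shape in which the tree carries (discrete) asymptotic freedom, [I]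
Thm 2's input; the window up to `n` puts every prefix in the box). [cite: Balaban1987RG1, Thm 2 ∕ (0.31) p.259, §1 p.264] -/
theorem betaAlongHistory_nonneg_of_betaLowerH {b γ : ℝ} {β : HBeta} (hb : 0 ≤ b) (hlow : BetaLowerH b γ β) {g : ℕ → ℝ} {n : ℕ}
    (hI : Step.InInterval γ n g) : ∀ j, j < n → 0 ≤ β j (prefixOf g j) := fun j hj =>
  hb.trans (hlow j _ (mem_box.mpr fun i => hI i (by have := i.isLt; omega)))

end Monotone

/-! ## §4. At NODE 00's record: `N₀` of record, print's first condition as a theorem, the (1.89) display and the `N₀`-pinned residual layer -/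

section AtRecord

open DagBinding T4Continuum Node00
open B15 (Ineq180)
open B15.BasicStep (Claim189)
open B15.PrelimIntegrations (Ineq191 Ineq195)
open B15Chi124DetSets (E124)
open B15Claim189Assembly (Setting189 new189 chiPP X dom domK half)
open B15Claim189PinAtRecord (D189OfRecord)
open B15Claim189PrintedConditions (omegaOfChain sitOfTerm claim189_sitOfTerm_of_inInterval claim189_sitOfTerm_of_flow)
open B15DeterminingSets (MSField)
open B14DomainGeom (Pt)
open B8Eq17ClassAkV1 (plaqsOf)
open GaugeGroup (dist1)
open GaugeField (plaqHol)
open FlowStep (HBeta prefixOf BetaUpperH)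
open B14FlowStep (SmallnessFor)

variable {F : T4Family} {N : ℕ} [NeZero N]

/-- **`N₀` OF RECORD** at run `P` and level `k`: print's number for the run's coupling history `gOfRecord₁₀ θ P` and the record's `L`, `r` (`R_j = RkOfRecord L r g_j`, def-R's (2.5) of
record). [cite: Balaban1989LargeFieldI, p.200, p.181] -/
def N0OfRecord (θ : Stage9Params F N) (P : B12.RunParams) (k : ℕ) : ℕ :=
  N0OfSeq (F.P P.K).L θ.ν.r (gOfRecord₁₀ F N θ P) k

variable (θ : Stage9Params F N) (P : B12.RunParams) (k : ℕ)

/-- The torus scale of record has `L ≥ 2` (`Params.hL : Odd L ∧ 1 < L`). [cite: Balaban1987RG1, (0.1) p.251 (bookkeeping)] -/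
theorem two_le_L : 2 ≤ (F.P P.K).L := by
  have := (F.P P.K).hL.2
  omega

/-- Unfolding (`rfl`). [cite: Balaban1989LargeFieldI, p.200 (bookkeeping)] -/
theorem N0OfRecord_eq : N0OfRecord θ P k = N0OfSeq (F.P P.K).L θ.ν.r (gOfRecord₁₀ F N θ P) k := rfl

/-- **`2 ≤ N₀` OF RECORD** from the top coupling: `1 < (log g_k⁻²)^r`. [cite: Balaban1989LargeFieldI, p.200, p.181] -/
theorem two_le_N0OfRecord (hg : 1 < (Real.log (gOfRecord₁₀ F N θ P k ^ 2)⁻¹) ^ θ.ν.r) : 2 ≤ N0OfRecord θ P k :=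
  two_le_N0OfSeq θ.ν.r (gOfRecord₁₀ F N θ P) k (two_le_L P) hg

variable {θ P k} in
/-- **IN A (2.7)-SMALL WINDOW THE TOP COUPLING PASSES `1 < (log g_k⁻²)^r`** (`r ≥ 1`): `0 < g_k ≤ γ < 1` and `4p₀ + 2 ≤ log γ⁻²` give `log g_k⁻² ≥ 2`, so `(log g_k⁻²)^r ≥ 2`.
[cite: Balaban1988Convergent, (2.5) p.255, (2.7) p.255] -/
theorem one_lt_log_pow_of_inInterval {γ β' β₀ : ℝ} {L p : ℕ} (S : SmallnessFor γ β' β₀ L p) (hI : Step.InInterval γ k (gOfRecord₁₀ F N θ P))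
    (hr : 1 ≤ θ.ν.r) : 1 < (Real.log (gOfRecord₁₀ F N θ P k ^ 2)⁻¹) ^ θ.ν.r := by
  obtain ⟨hg0, hgγ⟩ := hI k le_rfl
  have hp : (0 : ℝ) ≤ p := Nat.cast_nonneg _
  have hγ0 : 0 < γ := S.γ_pos
  have h2 : 2 ≤ Real.log (γ ^ 2)⁻¹ := by have := S.h27a; linarith
  have hmono : Real.log (γ ^ 2)⁻¹ ≤ Real.log (gOfRecord₁₀ F N θ P k ^ 2)⁻¹ :=
    Real.log_le_log (by positivity) (inv_anti₀ (by positivity) (by nlinarith))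
  have hge : (2 : ℝ) ≤ Real.log (gOfRecord₁₀ F N θ P k ^ 2)⁻¹ := h2.trans hmono
  calc (1 : ℝ) < 2 := one_lt_two
    _ = 2 ^ 1 := (pow_one _).symm
    _ ≤ 2 ^ θ.ν.r := pow_le_pow_right₀ one_le_two hr
    _ ≤ (Real.log (gOfRecord₁₀ F N θ P k ^ 2)⁻¹) ^ θ.ν.r := pow_le_pow_left₀ (by norm_num) hge _

/-- **`R_k ≤ L^{N₀−1}` OF RECORD** for a run whose couplings do not decrease from level `k+1−N₀` to `k` inside `]0, 1]`. [cite: Balaban1989LargeFieldI, p.200; Balaban1988Convergent, (2.5)–(2.6) p.255] -/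
theorem RkOfRecord_le_pow_N0OfRecord (hpos : 0 < gOfRecord₁₀ F N θ P (k + 1 - N0OfRecord θ P k))
    (hmono : gOfRecord₁₀ F N θ P (k + 1 - N0OfRecord θ P k) ≤ gOfRecord₁₀ F N θ P k) (hle : gOfRecord₁₀ F N θ P k ≤ 1) :
    RkOfRecord (F.P P.K).L θ.ν.r (gOfRecord₁₀ F N θ P k) ≤ (F.P P.K).L ^ (N0OfRecord θ P k - 1) :=
  RkOfRecord_le_pow_N0OfSeq θ.ν.r (gOfRecord₁₀ F N θ P) k (two_le_L P) hpos hmono hle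

variable {θ P k} in
/-- **PRINT'S FIRST p. 200 CONDITION AT THE RECORD IS A THEOREM OF ONE THRESHOLD**: for a run in the window `]0, γ]` up to `k` (`γ ≤ 1`) whose β-functions are nonnegative along its
history below `k`, with `1 < L₀`: `4(2 + C) ≤ ((log g_k⁻²)^r)^{α₀}` gives `(2 + C)·((L₀²)^{N₀−1})⁻¹ ≤ 1/4` at `N₀ := N0OfRecord θ P k`.
[cite: Balaban1989LargeFieldI, p.200 («≦ 1/4 for R_k^{−α₀}, or γ sufficiently small»); Balaban1988Convergent, (2.5)–(2.6) p.255; Balaban1987RG1, (0.20) p.256] -/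
theorem printCond1_N0OfRecord_of_threshold {γ L₀ C : ℝ} (hγ1 : γ ≤ 1) (hI : Step.InInterval γ k (gOfRecord₁₀ F N θ P))
    (hβ0 : ∀ j, j < k → 0 ≤ betaOfRecord₁₀ F N θ j (prefixOf (gOfRecord₁₀ F N θ P) j)) (hL₀ : 1 < L₀)
    (hwin : 4 * (2 + C) ≤ ((Real.log (gOfRecord₁₀ F N θ P k ^ 2)⁻¹) ^ θ.ν.r) ^ (Real.log (L₀ ^ 2) / Real.log ((F.P P.K).L : ℝ))) :
    (2 + C) * ((L₀ ^ 2) ^ (N0OfRecord θ P k - 1))⁻¹ ≤ 1 / 4 := by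
  have hN1 : 1 ≤ N0OfRecord θ P k := (N0OfSeq_spec θ.ν.r (gOfRecord₁₀ F N θ P) k (two_le_L P)).1
  have hpos : ∀ i, i ≤ k → 0 < gOfRecord₁₀ F N θ P i := fun i hi => (hI i hi).1
  have hmono : gOfRecord₁₀ F N θ P (k + 1 - N0OfRecord θ P k) ≤ gOfRecord₁₀ F N θ P k :=
    genSeq_mono_of_beta_nonneg (betaOfRecord₁₀ F N θ) P.g0 hpos hβ0 (by omega) le_rfl
  have hle : gOfRecord₁₀ F N θ P k ≤ 1 := (hI k le_rfl).2.trans hγ1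
  have hRk := RkOfRecord_le_pow_N0OfRecord θ P k (hpos _ (by omega)) hmono hle
  have hX0 : 0 ≤ (Real.log (gOfRecord₁₀ F N θ P k ^ 2)⁻¹) ^ θ.ν.r := by
    apply pow_nonneg
    apply Real.log_nonneg
    have hg := hpos k le_rfl
    exact one_le_inv_iff₀.mpr ⟨by positivity, by nlinarith⟩
  exact printCond1_of_threshold (two_le_L P) hL₀ hRk hX0 (log_pow_le_RkOfRecord (two_le_L P) θ.ν.r _) hwin

variable {θ P k} in
/-- **… HENCE OF THE WINDOW ALONE, WITH AN EXPLICIT `γ₀`** (§2's `threshold_of_le_gamma0`): for a run in `]0, γ]` up to `k` with `γ ≤ 1` and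
`γ ≤ γ₀ := exp(−X/2)`, `X := ((max(4(2+C), 1))^{1/α₀})^{1/r}`, `α₀ := (log L₀²)/(log L)` (`1 < L₀`, `r ≥ 1`), and `β ≥ 0` along the history below `k`, print's first condition holds
at `N₀ := N0OfRecord θ P k`. [cite: Balaban1989LargeFieldI, p.200 («or γ sufficiently small»); Balaban1988Convergent, (2.5)–(2.6) p.255] -/
theorem printCond1_N0OfRecord_of_le_gamma0 {γ L₀ C : ℝ} (hγ1 : γ ≤ 1) (hI : Step.InInterval γ k (gOfRecord₁₀ F N θ P))
    (hβ0 : ∀ j, j < k → 0 ≤ betaOfRecord₁₀ F N θ j (prefixOf (gOfRecord₁₀ F N θ P) j)) (hL₀ : 1 < L₀) (hr : 1 ≤ θ.ν.r)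
    (hγ₀ : γ ≤ Real.exp (-(((max (4 * (2 + C)) 1) ^ (1 / (Real.log (L₀ ^ 2) / Real.log ((F.P P.K).L : ℝ)))) ^ (1 / (θ.ν.r : ℝ)) / 2))) :
    (2 + C) * ((L₀ ^ 2) ^ (N0OfRecord θ P k - 1))⁻¹ ≤ 1 / 4 := by
  have hLr : (1 : ℝ) < ((F.P P.K).L : ℝ) := by exact_mod_cast (lt_of_lt_of_le one_lt_two (two_le_L P))
  have hα : 0 < Real.log (L₀ ^ 2) / Real.log ((F.P P.K).L : ℝ) := div_pos (Real.log_pos (by nlinarith)) (Real.log_pos hLr)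
  exact printCond1_N0OfRecord_of_threshold hγ1 hI hβ0 hL₀
    (threshold_of_le_gamma0 hα hr (hI k le_rfl).1 ((hI k le_rfl).2.trans hγ₀))

variable (σ : Sit189 F N P.K) {k' : ℕ} (s : SeqOfRecord F θ.ν θ.τ9.M (gOfRecord₁₀ F N θ P) P.K k') (p₁ : ℕ)

variable {θ P} in
/-- **(1.89) AT THE TERM'S FULLY PINNED LETTERS WITH `N₀ := N₀ OF RECORD`** — module 11's `claim189_sitOfTerm_of_inInterval` at `N₀ := N0OfRecord θ P k′` with `hN2 : 2 ≤ N₀` and print's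
first condition `hN₀` REPLACED by their sources: `r ≥ 1` (with the (2.7)-small window: `1 < (log g_{k′}⁻²)^r`), `β ≥ 0` along the run's history below `k′` (non-decreasing
couplings; displayed — the sign behind (2.6)), and ONE threshold `4(2 + (121/120)²O(1)B₃B₅M⁵) ≤ ((log g_{k′}⁻²)^r)^{α₀}`, `α₀ = (log L₀²)/(log L)`.  `N₀ ≤ N`, `N₀ ≤ k′`, print's SECOND condition (on `M`), `β, L₀`
(now `1 < L₀` used: `2 ≤ L₀`), signs, the window, the located geometry, the ℍ-leaves and (1.80) stay displayed. [cite: Balaban1989LargeFieldI, (1.89) p.198, pp.199–200; Balaban1988Convergent, (2.1) p.254, (2.5)–(2.8) pp.255–256] -/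
theorem claim189_sitOfTerm_N0_of_inInterval
    {D : Setting189 (F.P P.K) (SU N) (MSField (F.P P.K) (SU N) × ((j : ℕ) → VecField (F.P P.K) j (EuclideanSpace ℝ (Fin (N ^ 2 - 1))))) (Pt (F.P P.K).d)}
    (hD : D = D189OfRecord θ P (sitOfTerm θ P σ s (N0OfRecord θ P k') p₁))
    -- levels (`2 ≤ N₀` now from the window and `r ≥ 1`)
    (hr : 1 ≤ θ.ν.r) (hNN : N0OfRecord θ P k' ≤ θ.τ9.Nmem) (hNk : N0OfRecord θ P k' ≤ k')
    -- residual numerics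
    (hβ0 : 0 ≤ σ.β) (hβ : σ.β ≤ 1 / 4) (hL₀ : 2 ≤ σ.L₀) (hL₀L : σ.L₀ ^ 2 ≤ ((F.P P.K).L : ℝ))
    (hB : 0 ≤ σ.O1 * σ.B₃ * σ.B₅) (hδ : 0 ≤ σ.δ) (hdist : ∀ p, 0 ≤ σ.dist p)
    -- print's first condition: the threshold on the top coupling and β ≥ 0 along the history; print's second condition (on `M`)
    (hwin : 4 * (2 + (121 / 120) ^ 2 * (σ.O1 * σ.B₃ * σ.B₅ * (θ.τ9.M : ℝ) ^ 5))
      ≤ ((Real.log (gOfRecord₁₀ F N θ P k' ^ 2)⁻¹) ^ θ.ν.r) ^ (Real.log (σ.L₀ ^ 2) / Real.log ((F.P P.K).L : ℝ)))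
    (hβhist : ∀ j, j < k' → 0 ≤ betaOfRecord₁₀ F N θ j (prefixOf (gOfRecord₁₀ F N θ P) j))
    (hMl : (121 / 120) ^ 2 * (σ.O1 * σ.B₃ * σ.B₅ * (θ.τ9.M : ℝ) ^ 5) * Real.exp (-(4 * σ.δ * (θ.τ9.M : ℝ))) ≤ 1 / 12)
    -- the window and the flow numerics
    (hA₀ : 0 ≤ θ.ν.A₀) {β' β₀ : ℝ} {L : ℕ} (S : SmallnessFor θ.γ β' β₀ L θ.ν.p₀) (hβ₀ : β₀ ≤ 1 / 2)
    (hε10 : θ.γ * p0Profile θ.ν.A₀ θ.ν.p₀ θ.γ ≤ 1 / 10)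
    (hI : Step.InInterval θ.γ k' (gOfRecord₁₀ F N θ P))
    (hub : ∀ j, j < k' → betaOfRecord₁₀ F N θ j (prefixOf (gOfRecord₁₀ F N θ P) j) ≤ β')
    -- the located geometry
    (hZk : ∀ m, k' - N0OfRecord θ P k' < m → m < k' → σ.Zpp k' ∩ omegaOfChain s m ⊆ omegaOfChain s (m + 1))
    (hgeom : ∀ m, D.k₀ < m → m < D.k → ∀ p ∈ plaqsOf (D.Ω m \ D.Ω (m + 1)), 4 * ((m : ℝ) - D.k₀) * D.M ≤ D.dist p)
    (hbox : ∀ p ∈ plaqsOf (half D), D.boxOf p ∈ D.halfcubes ∧ p ∈ D.plaqT (D.boxOf p))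
    -- the ℍ-leaves and (1.80)
    (L91h : ∀ U, new189 D U → ∀ p ∈ plaqsOf (half D),
      Ineq191 (dist1 (plaqHol (D.Upp U) p)) (D.devV'' U p) D.α ((D.L ^ D.h)⁻¹) (D.ε D.h) (E124 D.ε D.L D.η D.k D.h))
    (L95 : ∀ U, new189 D U → ∀ p ∈ plaqsOf (half D),
      Ineq195 (D.devV'' U p) (dist1 (plaqHol (D.Uhalf U (D.boxOf p)) p)) D.α ((D.L ^ D.h)⁻¹) (D.ε D.h) (E124 D.ε D.L D.η D.k D.h))
    (L91 : ∀ U, new189 D U → ∀ j, D.h ≤ j → j ≤ D.k → ∀ p ∈ plaqsOf (dom D j),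
      Ineq191 (dist1 (plaqHol (D.Upp U) p)) (D.dev97 U p) D.α ((D.L ^ j)⁻¹) (D.ε j) (E124 D.ε D.L D.η D.k j))
    (L97 : ∀ U, new189 D U → ∀ j, D.h ≤ j → j ≤ D.k → ∀ p ∈ plaqsOf (dom D j),
      Ineq191 (D.dev97 U p) (D.dev0 U p) D.α ((D.L ^ j)⁻¹) (D.ε j) (E124 D.ε D.L D.η D.k j))
    (L80 : ∀ U, new189 D U → ∀ j, D.h ≤ j → j ≤ D.k → ∀ p ∈ plaqsOf (dom D j),
      Ineq180 (D.dev0 U p) (D.ε D.k) D.η D.B₃ D.B₅ D.M D.δ (D.dist p) D.O1) :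
    Claim189 (new189 D) (chiPP D) :=
  claim189_sitOfTerm_of_inInterval P σ s (N0OfRecord θ P k') p₁ hD (two_le_N0OfRecord θ P k' (one_lt_log_pow_of_inInterval S hI hr)) hNN hNk hβ0 hβ hL₀ hL₀L
    hB hδ hdist (printCond1_N0OfRecord_of_threshold S.γ_lt_one.le hI hβhist (by linarith) hwin) hMl hA₀ S hβ₀ hε10 hI hub hZk hgeom hbox L91h L95 L91 L97 L80

variable {θ P} in
/-- **THE SAME, WINDOW-FREE FORM** (module 11's `claim189_sitOfTerm_of_flow` at `N₀ := N0OfRecord θ P k′`): the flow inputs `hε0 ∕ hε1 ∕ hflow` DISPLAYED; the run's history in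
`]0, γ]` up to `k′` with `γ ≤ 1` (any `γ`, e.g. the witness lines' `1/2`) and `β ≥ 0` below `k′` feed the definition of `N₀`. [cite: Balaban1989LargeFieldI, (1.89) p.198, pp.199–200; Balaban1988Convergent, (2.5)–(2.8) pp.255–256] -/
theorem claim189_sitOfTerm_N0_of_flow
    {D : Setting189 (F.P P.K) (SU N) (MSField (F.P P.K) (SU N) × ((j : ℕ) → VecField (F.P P.K) j (EuclideanSpace ℝ (Fin (N ^ 2 - 1))))) (Pt (F.P P.K).d)}
    (hD : D = D189OfRecord θ P (sitOfTerm θ P σ s (N0OfRecord θ P k') p₁))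
    (hg1 : 1 < (Real.log (gOfRecord₁₀ F N θ P k' ^ 2)⁻¹) ^ θ.ν.r) (hNN : N0OfRecord θ P k' ≤ θ.τ9.Nmem) (hNk : N0OfRecord θ P k' ≤ k')
    (hβ0 : 0 ≤ σ.β) (hβ : σ.β ≤ 1 / 4) (hL₀ : 2 ≤ σ.L₀) (hL₀L : σ.L₀ ^ 2 ≤ ((F.P P.K).L : ℝ))
    (hB : 0 ≤ σ.O1 * σ.B₃ * σ.B₅) (hδ : 0 ≤ σ.δ) (hdist : ∀ p, 0 ≤ σ.dist p)
    (hwin : 4 * (2 + (121 / 120) ^ 2 * (σ.O1 * σ.B₃ * σ.B₅ * (θ.τ9.M : ℝ) ^ 5))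
      ≤ ((Real.log (gOfRecord₁₀ F N θ P k' ^ 2)⁻¹) ^ θ.ν.r) ^ (Real.log (σ.L₀ ^ 2) / Real.log ((F.P P.K).L : ℝ)))
    {γ : ℝ} (hγ1 : γ ≤ 1) (hIγ : Step.InInterval γ k' (gOfRecord₁₀ F N θ P))
    (hβhist : ∀ j, j < k' → 0 ≤ betaOfRecord₁₀ F N θ j (prefixOf (gOfRecord₁₀ F N θ P) j))
    (hMl : (121 / 120) ^ 2 * (σ.O1 * σ.B₃ * σ.B₅ * (θ.τ9.M : ℝ) ^ 5) * Real.exp (-(4 * σ.δ * (θ.τ9.M : ℝ))) ≤ 1 / 12)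
    (hε0 : ∀ i, k' - θ.τ9.Nmem ≤ i → i ≤ k' → 0 ≤ epsOfRecord θ.ν (gOfRecord₁₀ F N θ P) i)
    (hε1 : ∀ i, k' - θ.τ9.Nmem ≤ i → i ≤ k' → epsOfRecord θ.ν (gOfRecord₁₀ F N θ P) i ≤ 1 / 10)
    {β₀ : ℝ} (hβ₀0 : 0 ≤ β₀) (hβ₀ : β₀ ≤ 1 / 2)
    (hflow : ∀ j, k' - θ.τ9.Nmem ≤ j → j < k' →
      epsOfRecord θ.ν (gOfRecord₁₀ F N θ P) k' ≤ (1 + β₀) * Real.sqrt ((k' - j : ℕ) : ℝ) * epsOfRecord θ.ν (gOfRecord₁₀ F N θ P) j)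
    (hZk : ∀ m, k' - N0OfRecord θ P k' < m → m < k' → σ.Zpp k' ∩ omegaOfChain s m ⊆ omegaOfChain s (m + 1))
    (hgeom : ∀ m, D.k₀ < m → m < D.k → ∀ p ∈ plaqsOf (D.Ω m \ D.Ω (m + 1)), 4 * ((m : ℝ) - D.k₀) * D.M ≤ D.dist p)
    (hbox : ∀ p ∈ plaqsOf (half D), D.boxOf p ∈ D.halfcubes ∧ p ∈ D.plaqT (D.boxOf p))
    (L91h : ∀ U, new189 D U → ∀ p ∈ plaqsOf (half D),
      Ineq191 (dist1 (plaqHol (D.Upp U) p)) (D.devV'' U p) D.α ((D.L ^ D.h)⁻¹) (D.ε D.h) (E124 D.ε D.L D.η D.k D.h))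
    (L95 : ∀ U, new189 D U → ∀ p ∈ plaqsOf (half D),
      Ineq195 (D.devV'' U p) (dist1 (plaqHol (D.Uhalf U (D.boxOf p)) p)) D.α ((D.L ^ D.h)⁻¹) (D.ε D.h) (E124 D.ε D.L D.η D.k D.h))
    (L91 : ∀ U, new189 D U → ∀ j, D.h ≤ j → j ≤ D.k → ∀ p ∈ plaqsOf (dom D j),
      Ineq191 (dist1 (plaqHol (D.Upp U) p)) (D.dev97 U p) D.α ((D.L ^ j)⁻¹) (D.ε j) (E124 D.ε D.L D.η D.k j))
    (L97 : ∀ U, new189 D U → ∀ j, D.h ≤ j → j ≤ D.k → ∀ p ∈ plaqsOf (dom D j),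
      Ineq191 (D.dev97 U p) (D.dev0 U p) D.α ((D.L ^ j)⁻¹) (D.ε j) (E124 D.ε D.L D.η D.k j))
    (L80 : ∀ U, new189 D U → ∀ j, D.h ≤ j → j ≤ D.k → ∀ p ∈ plaqsOf (dom D j),
      Ineq180 (D.dev0 U p) (D.ε D.k) D.η D.B₃ D.B₅ D.M D.δ (D.dist p) D.O1) :
    Claim189 (new189 D) (chiPP D) :=
  claim189_sitOfTerm_of_flow P σ s (N0OfRecord θ P k') p₁ hD (two_le_N0OfRecord θ P k' hg1) hNN hNk hβ0 hβ hL₀ hL₀L hB hδ hdist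
    (printCond1_N0OfRecord_of_threshold hγ1 hIγ hβhist (by linarith) hwin) hMl hε0 hε1 hβ₀0 hβ₀ hflow hZk hgeom hbox L91h L95 L91 L97 L80

end AtRecord

section Layer

open DagBinding T4Continuum Node00
open B15 (Ineq180)
open B15.BasicStep (Claim189)
open B15.PrelimIntegrations (Ineq191 Ineq195)
open B15Chi124DetSets (E124)
open B15Claim189Assembly (Setting189 new189 chiPP X dom domK half)
open B15Claim189PinAtRecord (D189OfRecord)
open B15Claim189PrintedConditions (omegaOfChain sitOfTerm)
open B15DeterminingSets (MSField)
open B14DomainGeom (Pt)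
open B8Eq17ClassAkV1 (plaqsOf)
open GaugeGroup (dist1)
open GaugeField (plaqHol)
open FlowStep (HBeta prefixOf BetaUpperH)
open B14FlowStep (SmallnessFor)

variable {F : T4Family} {N : ℕ} [NeZero N]

/-- **THE RESIDUAL [IV] LAYER WITH THE (1.89) LETTERS PINNED TO THE RECORD'S OBJECTS INCLUDING `N₀` OF RECORD**: module 11's term pin + module 10's numbers pin read at
`N₀ := N0OfRecord θ P (kSel P + 1)` (per run), then `χ′` and `dev0` (`pinD189χ₀`).  Levels: `k = kSel P + 1`, `h = k − N`, `k₀ = k − N₀(P)`.  Data, no law.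
[cite: Balaban1989LargeFieldI, (1.89) p.198, p.200, p.181; Balaban1988Convergent, (2.5) p.255] -/
def _root_.Literature.MathematicalPhysics.QuantumFieldTheory.Balaban1983to89.Node00.ResidW.pinD189N (lam : ResidW F N) (θ : Stage9Params F N)
    (σ : ∀ P : B12.RunParams, Sit189 F N P.K)
    (s : ∀ P : B12.RunParams, SeqOfRecord F θ.ν θ.τ9.M (gOfRecord₁₀ F N θ P) P.K (lam.kSel P + 1)) (p₁ : ℕ) : ResidW F N :=
  lam.pinD189χ₀ θ (fun P => ((σ P).pinTerm (s P)).pinNumerics θ.τ9 (N0OfRecord θ P (lam.kSel P + 1))) p₁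

variable (θ : Stage9Params F N) (lam : ResidW F N) (σT : ∀ P : B12.RunParams, Sit189 F N P.K)
  (sT : ∀ P : B12.RunParams, SeqOfRecord F θ.ν θ.τ9.M (gOfRecord₁₀ F N θ P) P.K (lam.kSel P + 1)) (p₁ : ℕ)

/-- Unfolding (`rfl`). [cite: Balaban1989LargeFieldI, (1.89) p.198 (bookkeeping)] -/
theorem pinD189N_eq : lam.pinD189N θ σT sT p₁ = lam.pinD189χ₀ θ (fun P => ((σT P).pinTerm (sT P)).pinNumerics θ.τ9 (N0OfRecord θ P (lam.kSel P + 1))) p₁ := rfl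

/-- At run `P` its letters ARE those of module 11's term-pinned layer read at `N₀ := N0OfRecord θ P (kSel P + 1)` (`rfl`) — so every module 11 ∕ TermPin theorem applies run by run.
[cite: Balaban1989LargeFieldI, (1.89) p.198 (bookkeeping)] -/
theorem pinD189N_D189 (P : B12.RunParams) :
    (lam.pinD189N θ σT sT p₁).D189 P = (lam.pinD189T θ σT sT (N0OfRecord θ P (lam.kSel P + 1)) p₁).D189 P := rfl

/-- Its levels: `k = kSel P + 1`, `h = kSel P + 1 − N`, `k₀ = kSel P + 1 − N₀(P)` (`rfl`); the step selector, the Proposition-1 carrier and the (1.100) data are `λ`'s.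
[cite: Balaban1989LargeFieldI, p.177, p.178, p.181, p.200 (bookkeeping)] -/
theorem pinD189N_levels (P : B12.RunParams) : ((lam.pinD189N θ σT sT p₁).D189 P).k = lam.kSel P + 1 ∧ ((lam.pinD189N θ σT sT p₁).D189 P).h = lam.kSel P + 1 - θ.τ9.Nmem ∧
    ((lam.pinD189N θ σT sT p₁).D189 P).k₀ = lam.kSel P + 1 - N0OfRecord θ P (lam.kSel P + 1) ∧
    (lam.pinD189N θ σT sT p₁).kSel = lam.kSel ∧ (lam.pinD189N θ σT sT p₁).LF = lam.LF ∧ (lam.pinD189N θ σT sT p₁).D1100 = lam.D1100 := ⟨rfl, rfl, rfl, rfl, rfl, rfl⟩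

/-- The pin commutes with module 2's (1.100) pin (`rfl`). [cite: Balaban1989LargeFieldI, (1.89) p.198, (1.100) p.201 (bookkeeping)] -/
theorem pinD189N_pinRPrime_comm : (lam.pinD189N θ σT sT p₁).pinRPrime θ = (lam.pinRPrime θ).pinD189N θ σT sT p₁ := rfl

variable {θ}

/-- **dag-n12-d's `h189` SLOT AT THE `N₀`-PINNED LAYER FROM ITS `h180` SLOT** (window form): for the letters `D = (λ.pinD189N θ σ s p₁).D189 P` (`hD`, instantiate `rfl`), the (1.89) display from
(1.80), the four ℍ-leaves, the located geometry, `β, L₀`, signs, print's SECOND condition, `N₀(P) ≤ N`, `N₀(P) ≤ kSel P + 1`, `r ≥ 1`, the top coupling's threshold, `β ≥ 0` along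
the history, and the run's (2.7)-small window (BOX form of the β bound). [cite: Balaban1989LargeFieldI, (1.89) p.198, pp.199–200; Balaban1988Convergent, (2.1) p.254, (2.5)–(2.8) pp.255–256] -/
theorem h189_pinD189N_of_h180 (P : B12.RunParams)
    {D : Setting189 (F.P P.K) (SU N) (MSField (F.P P.K) (SU N) × ((j : ℕ) → VecField (F.P P.K) j (EuclideanSpace ℝ (Fin (N ^ 2 - 1))))) (Pt (F.P P.K).d)}
    (hD : D = (lam.pinD189N θ σT sT p₁).D189 P) (hr : 1 ≤ θ.ν.r)
    (hNN : N0OfRecord θ P (lam.kSel P + 1) ≤ θ.τ9.Nmem) (hNk : N0OfRecord θ P (lam.kSel P + 1) ≤ lam.kSel P + 1)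
    (hβ0 : 0 ≤ (σT P).β) (hβ : (σT P).β ≤ 1 / 4) (hL₀ : 2 ≤ (σT P).L₀) (hL₀L : (σT P).L₀ ^ 2 ≤ ((F.P P.K).L : ℝ))
    (hB : 0 ≤ (σT P).O1 * (σT P).B₃ * (σT P).B₅) (hδ : 0 ≤ (σT P).δ) (hdist : ∀ p, 0 ≤ (σT P).dist p)
    (hwin : 4 * (2 + (121 / 120) ^ 2 * ((σT P).O1 * (σT P).B₃ * (σT P).B₅ * (θ.τ9.M : ℝ) ^ 5))
      ≤ ((Real.log (gOfRecord₁₀ F N θ P (lam.kSel P + 1) ^ 2)⁻¹) ^ θ.ν.r) ^ (Real.log ((σT P).L₀ ^ 2) / Real.log ((F.P P.K).L : ℝ)))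
    (hβhist : ∀ j, j < lam.kSel P + 1 → 0 ≤ betaOfRecord₁₀ F N θ j (prefixOf (gOfRecord₁₀ F N θ P) j))
    (hMl : (121 / 120) ^ 2 * ((σT P).O1 * (σT P).B₃ * (σT P).B₅ * (θ.τ9.M : ℝ) ^ 5) * Real.exp (-(4 * (σT P).δ * (θ.τ9.M : ℝ))) ≤ 1 / 12)
    (hA₀ : 0 ≤ θ.ν.A₀) {β' β₀ : ℝ} {L : ℕ} (S : SmallnessFor θ.γ β' β₀ L θ.ν.p₀) (hβ₀ : β₀ ≤ 1 / 2) (hε10 : θ.γ * p0Profile θ.ν.A₀ θ.ν.p₀ θ.γ ≤ 1 / 10)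
    (hI : Step.InInterval θ.γ (lam.kSel P + 1) (gOfRecord₁₀ F N θ P)) (hup : BetaUpperH β' θ.γ (betaOfRecord₁₀ F N θ))
    (hZk : ∀ m, lam.kSel P + 1 - N0OfRecord θ P (lam.kSel P + 1) < m → m < lam.kSel P + 1 →
      (σT P).Zpp (lam.kSel P + 1) ∩ omegaOfChain (sT P) m ⊆ omegaOfChain (sT P) (m + 1))
    (hgeom : ∀ m, D.k₀ < m → m < D.k → ∀ p ∈ plaqsOf (D.Ω m \ D.Ω (m + 1)), 4 * ((m : ℝ) - D.k₀) * D.M ≤ D.dist p)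
    (hbox : ∀ p ∈ plaqsOf (half D), D.boxOf p ∈ D.halfcubes ∧ p ∈ D.plaqT (D.boxOf p))
    (L91h : ∀ U, new189 D U → ∀ p ∈ plaqsOf (half D),
      Ineq191 (dist1 (plaqHol (D.Upp U) p)) (D.devV'' U p) D.α ((D.L ^ D.h)⁻¹) (D.ε D.h) (E124 D.ε D.L D.η D.k D.h))
    (L95 : ∀ U, new189 D U → ∀ p ∈ plaqsOf (half D),
      Ineq195 (D.devV'' U p) (dist1 (plaqHol (D.Uhalf U (D.boxOf p)) p)) D.α ((D.L ^ D.h)⁻¹) (D.ε D.h) (E124 D.ε D.L D.η D.k D.h))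
    (L91 : ∀ U, new189 D U → ∀ j, D.h ≤ j → j ≤ D.k → ∀ p ∈ plaqsOf (dom D j),
      Ineq191 (dist1 (plaqHol (D.Upp U) p)) (D.dev97 U p) D.α ((D.L ^ j)⁻¹) (D.ε j) (E124 D.ε D.L D.η D.k j))
    (L97 : ∀ U, new189 D U → ∀ j, D.h ≤ j → j ≤ D.k → ∀ p ∈ plaqsOf (dom D j),
      Ineq191 (D.dev97 U p) (D.dev0 U p) D.α ((D.L ^ j)⁻¹) (D.ε j) (E124 D.ε D.L D.η D.k j))
    (h180 : ∀ U, new189 D U → ∀ i, D.h ≤ i → i ≤ D.k → ∀ q ∈ plaqsOf (dom D i), Ineq180 (D.dev0 U q) (D.ε D.k) D.η D.B₃ D.B₅ D.M D.δ (D.dist q) D.O1) :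
    Claim189 (new189 D) (chiPP D) :=
  claim189_sitOfTerm_N0_of_inInterval (σT P) (sT P) p₁ hD hr hNN hNk hβ0 hβ hL₀ hL₀L hB hδ hdist hwin hβhist hMl hA₀ S hβ₀ hε10 hI
    (B15Claim189FlowAtRecord.betaAlongHistory_le_of_betaUpperH hup hI) hZk hgeom hbox L91h L95 L91 L97 h180

/-- **THE SAME, WINDOW-FREE FORM** (flow inputs displayed; the history in `]0, γ]`, `γ ≤ 1`, feeds only the definition of `N₀`). [cite: Balaban1989LargeFieldI, (1.89) p.198, pp.199–200; Balaban1988Convergent, (2.5)–(2.8) pp.255–256] -/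
theorem h189_pinD189N_of_h180_of_flow (P : B12.RunParams)
    {D : Setting189 (F.P P.K) (SU N) (MSField (F.P P.K) (SU N) × ((j : ℕ) → VecField (F.P P.K) j (EuclideanSpace ℝ (Fin (N ^ 2 - 1))))) (Pt (F.P P.K).d)}
    (hD : D = (lam.pinD189N θ σT sT p₁).D189 P)
    (hg1 : 1 < (Real.log (gOfRecord₁₀ F N θ P (lam.kSel P + 1) ^ 2)⁻¹) ^ θ.ν.r)
    (hNN : N0OfRecord θ P (lam.kSel P + 1) ≤ θ.τ9.Nmem) (hNk : N0OfRecord θ P (lam.kSel P + 1) ≤ lam.kSel P + 1)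
    (hβ0 : 0 ≤ (σT P).β) (hβ : (σT P).β ≤ 1 / 4) (hL₀ : 2 ≤ (σT P).L₀) (hL₀L : (σT P).L₀ ^ 2 ≤ ((F.P P.K).L : ℝ))
    (hB : 0 ≤ (σT P).O1 * (σT P).B₃ * (σT P).B₅) (hδ : 0 ≤ (σT P).δ) (hdist : ∀ p, 0 ≤ (σT P).dist p)
    (hwin : 4 * (2 + (121 / 120) ^ 2 * ((σT P).O1 * (σT P).B₃ * (σT P).B₅ * (θ.τ9.M : ℝ) ^ 5))
      ≤ ((Real.log (gOfRecord₁₀ F N θ P (lam.kSel P + 1) ^ 2)⁻¹) ^ θ.ν.r) ^ (Real.log ((σT P).L₀ ^ 2) / Real.log ((F.P P.K).L : ℝ)))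
    {γ : ℝ} (hγ1 : γ ≤ 1) (hIγ : Step.InInterval γ (lam.kSel P + 1) (gOfRecord₁₀ F N θ P))
    (hβhist : ∀ j, j < lam.kSel P + 1 → 0 ≤ betaOfRecord₁₀ F N θ j (prefixOf (gOfRecord₁₀ F N θ P) j))
    (hMl : (121 / 120) ^ 2 * ((σT P).O1 * (σT P).B₃ * (σT P).B₅ * (θ.τ9.M : ℝ) ^ 5) * Real.exp (-(4 * (σT P).δ * (θ.τ9.M : ℝ))) ≤ 1 / 12)
    (hε0 : ∀ i, lam.kSel P + 1 - θ.τ9.Nmem ≤ i → i ≤ lam.kSel P + 1 → 0 ≤ epsOfRecord θ.ν (gOfRecord₁₀ F N θ P) i)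
    (hε1 : ∀ i, lam.kSel P + 1 - θ.τ9.Nmem ≤ i → i ≤ lam.kSel P + 1 → epsOfRecord θ.ν (gOfRecord₁₀ F N θ P) i ≤ 1 / 10)
    {β₀ : ℝ} (hβ₀0 : 0 ≤ β₀) (hβ₀ : β₀ ≤ 1 / 2)
    (hflow : ∀ j, lam.kSel P + 1 - θ.τ9.Nmem ≤ j → j < lam.kSel P + 1 →
      epsOfRecord θ.ν (gOfRecord₁₀ F N θ P) (lam.kSel P + 1) ≤ (1 + β₀) * Real.sqrt ((lam.kSel P + 1 - j : ℕ) : ℝ) * epsOfRecord θ.ν (gOfRecord₁₀ F N θ P) j)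
    (hZk : ∀ m, lam.kSel P + 1 - N0OfRecord θ P (lam.kSel P + 1) < m → m < lam.kSel P + 1 →
      (σT P).Zpp (lam.kSel P + 1) ∩ omegaOfChain (sT P) m ⊆ omegaOfChain (sT P) (m + 1))
    (hgeom : ∀ m, D.k₀ < m → m < D.k → ∀ p ∈ plaqsOf (D.Ω m \ D.Ω (m + 1)), 4 * ((m : ℝ) - D.k₀) * D.M ≤ D.dist p)
    (hbox : ∀ p ∈ plaqsOf (half D), D.boxOf p ∈ D.halfcubes ∧ p ∈ D.plaqT (D.boxOf p))
    (L91h : ∀ U, new189 D U → ∀ p ∈ plaqsOf (half D),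
      Ineq191 (dist1 (plaqHol (D.Upp U) p)) (D.devV'' U p) D.α ((D.L ^ D.h)⁻¹) (D.ε D.h) (E124 D.ε D.L D.η D.k D.h))
    (L95 : ∀ U, new189 D U → ∀ p ∈ plaqsOf (half D),
      Ineq195 (D.devV'' U p) (dist1 (plaqHol (D.Uhalf U (D.boxOf p)) p)) D.α ((D.L ^ D.h)⁻¹) (D.ε D.h) (E124 D.ε D.L D.η D.k D.h))
    (L91 : ∀ U, new189 D U → ∀ j, D.h ≤ j → j ≤ D.k → ∀ p ∈ plaqsOf (dom D j),
      Ineq191 (dist1 (plaqHol (D.Upp U) p)) (D.dev97 U p) D.α ((D.L ^ j)⁻¹) (D.ε j) (E124 D.ε D.L D.η D.k j))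
    (L97 : ∀ U, new189 D U → ∀ j, D.h ≤ j → j ≤ D.k → ∀ p ∈ plaqsOf (dom D j),
      Ineq191 (D.dev97 U p) (D.dev0 U p) D.α ((D.L ^ j)⁻¹) (D.ε j) (E124 D.ε D.L D.η D.k j))
    (h180 : ∀ U, new189 D U → ∀ i, D.h ≤ i → i ≤ D.k → ∀ q ∈ plaqsOf (dom D i), Ineq180 (D.dev0 U q) (D.ε D.k) D.η D.B₃ D.B₅ D.M D.δ (D.dist q) D.O1) :
    Claim189 (new189 D) (chiPP D) :=
  claim189_sitOfTerm_N0_of_flow (σT P) (sT P) p₁ hD hg1 hNN hNk hβ0 hβ hL₀ hL₀L hB hδ hdist hwin hγ1 hIγ hβhist hMl hε0 hε1 hβ₀0 hβ₀ hflow hZk hgeom hbox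
    L91h L95 L91 L97 h180

end Layer

/-! ## §5. (v1.1) Census: what `N₀(P) ≤ N` costs at constant `N`, and `N₀` on a stationary history -/

section Census

open Node00 (RkOfRecord isRj_RkOfRecord)
open DagBinding T4Continuum Node00
open FlowStep (HBeta prefixOf)

variable {L : ℕ} (r : ℕ) (g : ℕ → ℝ) (k : ℕ)

/-- **CENSUS — `N₀ ≤ N` AT CONSTANT `N` IS A LOWER EDGE ON THE COUPLING WINDOW**: for a history with non-decreasing couplings in `]0, 1]` up to `k`, `N₀ ≤ Nm` forces
`(log g_k⁻²)^r ≤ R_k ≤ L^{N₀−1} ≤ L^{Nm−1}`, i.e. `g_k ≥ exp(−½·L^{(Nm−1)/r})` — so with a CONSTANT memory `N` (def-R's `TowerNumerics.Nmem`) the displayed level input `N₀(P) ≤ N` of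
modules 10–12 excludes the runs whose top coupling is too small; print's `N` grows with `k` (*"N ≦ O(1)(log g_k⁻²)^ν … N has to be sufficiently large … These two conditions can be
satisfied by N to the positive power of log g_k⁻²"*, p. 198).  LOCATED design input for the numerics-of-the-family successor (cf. dag-n12-d's `Nmem = 0` census); count-neutral.
[cite: Balaban1989LargeFieldI, p.198, p.200; Balaban1988Convergent, (2.5) p.255] -/
theorem log_pow_le_pow_of_N0OfSeq_le (hL : 2 ≤ L) (hpos : 0 < g (k + 1 - N0OfSeq L r g k)) (hmono : g (k + 1 - N0OfSeq L r g k) ≤ g k) (hle : g k ≤ 1)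
    {Nm : ℕ} (hN : N0OfSeq L r g k ≤ Nm) : (Real.log (g k ^ 2)⁻¹) ^ r ≤ ((L ^ (Nm - 1) : ℕ) : ℝ) := by
  have h1 := log_pow_le_RkOfRecord hL r (g k)
  have h2 : RkOfRecord L r (g k) ≤ L ^ (Nm - 1) :=
    (RkOfRecord_le_pow_N0OfSeq r g k hL hpos hmono hle).trans (Nat.pow_le_pow_right (by omega) (by omega))
  exact h1.trans (by exact_mod_cast h2)

/-- **`N₀` ON A STATIONARY HISTORY** (all couplings equal to `g₀`, e.g. the β ≡ 0 model): `N₀ = s + 1` where `R(g₀) = L^s` — print's equation `R_{k−N₀+1} = L^{N₀−1}` holds on the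
nose, and `k₀ = k − N₀ = k − 1 − log_L R`. [cite: Balaban1989LargeFieldI, p.200 (bookkeeping witness)] -/
theorem N0OfSeq_const (hL : 2 ≤ L) (g₀ : ℝ) (k : ℕ) {s : ℕ} (hs : RkOfRecord L r g₀ = L ^ s) : N0OfSeq L r (fun _ => g₀) k = s + 1 := by
  apply le_antisymm
  · exact N0OfSeq_le_of r (fun _ => g₀) k hL (by omega) (by rw [hs, show s + 1 - 1 = s by omega])
  · by_contra hlt
    have hlt' : N0OfSeq L r (fun _ => g₀) k < s + 1 := not_le.mp hlt
    obtain ⟨h1, hspec⟩ := N0OfSeq_spec r (fun _ => g₀) k hL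
    rw [hs] at hspec
    have := Nat.pow_le_pow_iff_right (by omega : 2 ≤ L) |>.mp hspec
    omega

variable {F : T4Family} {N : ℕ} [NeZero N] {θ : Stage9Params F N} {P : B12.RunParams} {k : ℕ}

/-- **AT THE RECORD: `N₀(P) ≤ Nmem` BOUNDS THE TOP COUPLING FROM BELOW** — for a run in `]0, γ]` up to `k` (`γ ≤ 1`) with `β ≥ 0` along its history, the displayed level input
`N0OfRecord θ P k ≤ θ.τ9.Nmem` implies `(log g_k⁻²)^r ≤ L^{Nmem−1}`. [cite: Balaban1989LargeFieldI, p.198, p.200; Balaban1988Convergent, (2.5)–(2.6) p.255] -/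
theorem log_pow_le_pow_of_N0OfRecord_le {γ : ℝ} (hγ1 : γ ≤ 1) (hI : Step.InInterval γ k (gOfRecord₁₀ F N θ P))
    (hβ0 : ∀ j, j < k → 0 ≤ betaOfRecord₁₀ F N θ j (prefixOf (gOfRecord₁₀ F N θ P) j)) (hN : N0OfRecord θ P k ≤ θ.τ9.Nmem) :
    (Real.log (gOfRecord₁₀ F N θ P k ^ 2)⁻¹) ^ θ.ν.r ≤ (((F.P P.K).L ^ (θ.τ9.Nmem - 1) : ℕ) : ℝ) := by
  have hN1 : 1 ≤ N0OfRecord θ P k := (N0OfSeq_spec θ.ν.r (gOfRecord₁₀ F N θ P) k (two_le_L P)).1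
  have hpos : ∀ i, i ≤ k → 0 < gOfRecord₁₀ F N θ P i := fun i hi => (hI i hi).1
  have hmono : gOfRecord₁₀ F N θ P (k + 1 - N0OfRecord θ P k) ≤ gOfRecord₁₀ F N θ P k :=
    genSeq_mono_of_beta_nonneg (betaOfRecord₁₀ F N θ) P.g0 hpos hβ0 (by omega) le_rfl
  exact log_pow_le_pow_of_N0OfSeq_le θ.ν.r (gOfRecord₁₀ F N θ P) k (two_le_L P) (hpos (k + 1 - N0OfRecord θ P k) (by omega)) hmono
    ((hI k le_rfl).2.trans hγ1) hN

end Census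

/-! ## §6. (v1.2) `β ≥ 0` along the history IS the run's `betaPositive` leaf ([I] Thm 2's input, carried by the DAG world) -/

section Leaves

open DagBinding T4Continuum Node00
open FlowStep (HBeta prefixOf)
open FlowStepRuns (genFlow)
open B15Claim189FlowAtRecord (beta_genFlow_succ_apply)

variable {F : T4Family} {N : ℕ} [NeZero N] {θ : Stage9Params F N} {w : WorldP} {P : B12.RunParams}

/-- **THE DISPLAYED `β ≥ 0` ALONG THE HISTORY IS THE RUN'S `betaPositive` LEAF**: at a world whose construction carries the record's generated flow at the run `P`
(`(w.C P).flow = genFlow β₁₀ g₀`, as in module 5 §4), the leaf `(leavesP w P).betaPositive` (`w.b ≤ β_{j+1}(g_j)` for `j < K`, with the world's `w.b > 0` — the DAG's carrier of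
[I] Thm 2's positivity input, `Dag.Leaves.betaPositive`) gives `0 ≤ betaOfRecord₁₀ θ j (g_0,…,g_j)` for `j < n ≤ P.K` — the `hβhist` input of §4's theorems and of the `TermPin*`
leaves. [cite: Balaban1987RG1, Thm 2 ∕ (0.31) p.259, §1 p.264] -/
theorem betaAlongHistory_nonneg_of_betaPositive (hfl : (w.C P).flow = genFlow (betaOfRecord₁₀ F N θ) P.g0) (hpos : (leavesP w P).betaPositive) {n : ℕ} (hn : n ≤ P.K) :
    ∀ j, j < n → 0 ≤ betaOfRecord₁₀ F N θ j (prefixOf (gOfRecord₁₀ F N θ P) j) := by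
  have h' : ∀ j, j < P.K → w.b ≤ (w.C P).flow.β (j + 1) ((w.C P).flow.g j) := hpos
  rw [hfl] at h'
  intro j hj
  rw [← beta_genFlow_succ_apply (betaOfRecord₁₀ F N θ) P.g0 j]
  exact w.b_pos.le.trans (h' j (lt_of_lt_of_le hj hn))

/-- **… so at such a world the couplings of record do not decrease along the run** (`0 < g_i`, `i ≤ n ≤ K`, from the `smallCouplings` leaf; §3's `genSeq_mono_of_beta_nonneg`).
[cite: Balaban1987RG1, (0.20) p.256; Balaban1988Convergent, (2.6) p.255] -/
theorem gOfRecord₁₀_mono_of_leaves (hfl : (w.C P).flow = genFlow (betaOfRecord₁₀ F N θ) P.g0) (hsc : (leavesP w P).smallCouplings) (hpos : (leavesP w P).betaPositive)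
    {n : ℕ} (hn : n ≤ P.K) {i i' : ℕ} (hii' : i ≤ i') (hi' : i' ≤ n) : gOfRecord₁₀ F N θ P i ≤ gOfRecord₁₀ F N θ P i' := by
  have hsc' : (w.C P).flow.InInterval w.γ P.K := hsc
  rw [hfl] at hsc'
  exact genSeq_mono_of_beta_nonneg (betaOfRecord₁₀ F N θ) P.g0 (fun i hi => (hsc' i (hi.trans hn)).1)
    (betaAlongHistory_nonneg_of_betaPositive hfl hpos hn) hii' hi'

end Leaves

/-! ## §7. (v1.2) Per run `N₀ ≤ 1 + log_L R(g₀)` — the memory ONE run needs -/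

section PerRun

open Node00 (RkOfRecord isRj_RkOfRecord)
open DagBinding T4Continuum Node00
open FlowStep (HBeta prefixOf)

variable {L : ℕ} (r : ℕ) (g : ℕ → ℝ) (k : ℕ)

/-- **ALONG ONE RUN `N₀ ≤ s₀ + 1`, `R(g₀) = L^{s₀}`**: with non-decreasing couplings in `]0, 1]` the cube numbers only decrease, `R(g_{k−s₀}) ≤ R(g₀) = L^{s₀}`, so `n = s₀ + 1` solves
print's inequality — the memory a SINGLE run needs is `1 + log_L R(g₀)` (finite per run, unbounded over the window as `g₀ → 0`; cf. §5). [cite: Balaban1989LargeFieldI, p.179, p.198; Balaban1988Convergent, (2.5)–(2.6) p.255] -/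
theorem N0OfSeq_le_succ_log (hL : 2 ≤ L) {s₀ : ℕ} (hs : RkOfRecord L r (g 0) = L ^ s₀) (hpos : 0 < g 0)
    (hmono : g 0 ≤ g (k + 1 - (s₀ + 1))) (hle : g (k + 1 - (s₀ + 1)) ≤ 1) : N0OfSeq L r g k ≤ s₀ + 1 := by
  refine N0OfSeq_le_of r g k hL (by omega) ?_
  rw [show s₀ + 1 - 1 = s₀ by omega, ← hs]
  exact RkOfRecord_anti hL r hpos hmono hle

/-- **… AND CONVERSELY `N₀ ≤ Nm` FROM THE INITIAL COUPLING ALONE**: if `(log g₀⁻²)^r ≤ L^{Nm−1}` (i.e. `g₀ ≥ exp(−½·L^{(Nm−1)/r})`, `Nm ≥ 1`) then, couplings non-decreasing in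
`]0, 1]`, `R(g_{k+1−Nm}) ≤ R(g₀) ≤ L^{Nm−1}` and `N₀ ≤ Nm` — the displayed level input `N₀(P) ≤ Nmem` DISCHARGED from one condition on the run's initial coupling (with §5: the
condition is sharp up to the slow variation of `R`). [cite: Balaban1989LargeFieldI, p.179 («We assume that N > N₀»), p.198; Balaban1988Convergent, (2.5)–(2.6) p.255] -/
theorem N0OfSeq_le_of_log_pow_le (hL : 2 ≤ L) {Nm : ℕ} (h1 : 1 ≤ Nm) (hlog : (Real.log (g 0 ^ 2)⁻¹) ^ r ≤ ((L ^ (Nm - 1) : ℕ) : ℝ)) (hpos : 0 < g 0)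
    (hmono : g 0 ≤ g (k + 1 - Nm)) (hle : g (k + 1 - Nm) ≤ 1) : N0OfSeq L r g k ≤ Nm :=
  N0OfSeq_le_of r g k hL h1 ((RkOfRecord_anti hL r hpos hmono hle).trans (RkOfRecord_le_pow_of_le hL r (g 0) hlog))


variable {F : T4Family} {N : ℕ} [NeZero N] {θ : Stage9Params F N} {P : B12.RunParams} {k : ℕ}

/-- **AT THE RECORD**: for a run in `]0, γ]` up to `k` (`γ ≤ 1`) with `β ≥ 0` along its history, `N0OfRecord θ P k ≤ s₀ + 1` where `R(g₀(P)) = L^{s₀}` — one run is served by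
`Nmem = 1 + log_L R(g₀)`; over all runs of the window no constant serves (§5). [cite: Balaban1989LargeFieldI, p.179, p.198; Balaban1988Convergent, (2.5)–(2.6) p.255] -/
theorem N0OfRecord_le_succ_log {γ : ℝ} (hγ1 : γ ≤ 1) (hI : Step.InInterval γ k (gOfRecord₁₀ F N θ P))
    (hβ0 : ∀ j, j < k → 0 ≤ betaOfRecord₁₀ F N θ j (prefixOf (gOfRecord₁₀ F N θ P) j)) {s₀ : ℕ}
    (hs : RkOfRecord (F.P P.K).L θ.ν.r (gOfRecord₁₀ F N θ P 0) = (F.P P.K).L ^ s₀) : N0OfRecord θ P k ≤ s₀ + 1 := by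
  have hpos : ∀ i, i ≤ k → 0 < gOfRecord₁₀ F N θ P i := fun i hi => (hI i hi).1
  have hmono : gOfRecord₁₀ F N θ P 0 ≤ gOfRecord₁₀ F N θ P (k + 1 - (s₀ + 1)) :=
    genSeq_mono_of_beta_nonneg (betaOfRecord₁₀ F N θ) P.g0 hpos hβ0 (Nat.zero_le _) (by omega)
  exact N0OfSeq_le_succ_log θ.ν.r (gOfRecord₁₀ F N θ P) k (two_le_L P) hs (hpos 0 (Nat.zero_le _)) hmono
    (((hI _ (by omega)).2).trans hγ1)

/-- **AT THE RECORD: `N0OfRecord θ P k ≤ Nmem` FROM `(log g₀⁻²)^r ≤ L^{Nmem−1}`** (run in `]0, γ]` up to `k`, `γ ≤ 1`, `β ≥ 0` along the history, `Nmem ≥ 1`) — module 12's displayed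
`hNN` as a condition on the run's initial coupling. [cite: Balaban1989LargeFieldI, p.179, p.198; Balaban1988Convergent, (2.5)–(2.6) p.255] -/
theorem N0OfRecord_le_Nmem_of_log_pow_le {γ : ℝ} (hγ1 : γ ≤ 1) (hI : Step.InInterval γ k (gOfRecord₁₀ F N θ P))
    (hβ0 : ∀ j, j < k → 0 ≤ betaOfRecord₁₀ F N θ j (prefixOf (gOfRecord₁₀ F N θ P) j)) (h1 : 1 ≤ θ.τ9.Nmem)
    (hlog : (Real.log (gOfRecord₁₀ F N θ P 0 ^ 2)⁻¹) ^ θ.ν.r ≤ (((F.P P.K).L ^ (θ.τ9.Nmem - 1) : ℕ) : ℝ)) : N0OfRecord θ P k ≤ θ.τ9.Nmem := by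
  have hpos : ∀ i, i ≤ k → 0 < gOfRecord₁₀ F N θ P i := fun i hi => (hI i hi).1
  have hmono : gOfRecord₁₀ F N θ P 0 ≤ gOfRecord₁₀ F N θ P (k + 1 - θ.τ9.Nmem) :=
    genSeq_mono_of_beta_nonneg (betaOfRecord₁₀ F N θ) P.g0 hpos hβ0 (Nat.zero_le _) (by omega)
  exact N0OfSeq_le_of_log_pow_le θ.ν.r (gOfRecord₁₀ F N θ P) k (two_le_L P) h1 hlog (hpos 0 (Nat.zero_le _)) hmono (((hI _ (by omega)).2).trans hγ1)

end PerRun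

end B15Claim189N0OfRecord

end Literature.MathematicalPhysics.QuantumFieldTheory.Balaban1983to89

end
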